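import Summits.AtomisticToContinuum.FouriersLaw.Theorems.OddSectorIrreversibilityOddCorrectorDecayVariationAlgebra
import Summits.AtomisticToContinuum.FouriersLaw.Theorems.OddSectorIrreversibilityOddCorrectorDecayOneSite
import Summits.AtomisticToContinuum.FouriersLaw.Theorems.BondHeatUncertaintySubdiffusiveBondHeatKernelGibbsA

/-!
# Extensivity of the current's `L²(Gibbs)` norm, III: one-site moments in real form; the force is one-site dominated

Support file for item `stmt-AtomisticToContinuum-9139` (`OddSectorIrreversibility.OddCorrectorDecay`), negative
side (static input `M_N ≥ c (N - 2) Z_N` of the bath-locality estimate).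
* `pinnedChain_integral_coord_pow_mul_gibbsDensity_le` — real form of the one-site domination
  `ChainVariation.pinnedChain_lintegral_coord_gibbsWeight_le`: `∫ q_k^{2j} e^{-H/T} ≤ κ_{2j} ∫ e^{-H/T}` with the
  one-site moment ratio `κ_{2j} = ∫ a^{2j} e^{-U(a)/T} da / ∫ e^{-U(a)/T} da`, uniformly in `N` and `k`;
* `pinnedChain_dPotential_sq_le` — `(∂_iΦ)²` is dominated by quadratic-plus-sextic one-site terms at `i` and its
  (at most two) neighbours; `pinnedChain_integral_quadSext_le` — their Gibbs integrals are `O(Z_N)` uniformly.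
-/

noncomputable section

open MeasureTheory Finset Set
open scoped ENNReal
open Literature.MathematicalPhysics.KineticTheory.HeatConduction
open Summit.AtomisticToContinuum.FouriersLaw.Theorems.SubdiffusiveBondHeat

namespace Summit.AtomisticToContinuum.FouriersLaw.Theorems.ChainVariation

variable {N : ℕ}

/-! ### One-site moments, real form -/

section OneSiteReal

variable {ω₂ lam β : ℝ} (hω : 0 < ω₂) (hl : 0 ≤ lam) (hβ : 0 ≤ β) (γ : ℝ) {T : ℝ} (hT : 0 < T)
include hω hl hβ hT

omit hβ in
/-- The even one-site moments of `e^{-U/T}` are finite: `∫ a^{2j} e^{-U(a)/T} da < ∞`. [folklore] -/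
theorem pinnedChain_lintegral_pow_mul_exp_neg_U_ne_top (j : ℕ) :
    ∫⁻ a, ENNReal.ofReal (a ^ (2 * j)) * ENNReal.ofReal (Real.exp (-(pinnedChain ω₂ lam β γ).U a / T)) ≠ ⊤ := by
  have h2j : ∀ a : ℝ, 0 ≤ a ^ (2 * j) := fun a => by rw [pow_mul]; positivity
  have hc : Continuous fun a : ℝ => a ^ (2 * j) * Real.exp (-(pinnedChain ω₂ lam β γ).U a / T) := by
    have hUc : Continuous (pinnedChain ω₂ lam β γ).U := (pinnedChain_contDiff_U ω₂ lam β γ (n := 0)).continuous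
    fun_prop
  have e : (fun a : ℝ => ENNReal.ofReal (a ^ (2 * j)) *
      ENNReal.ofReal (Real.exp (-(pinnedChain ω₂ lam β γ).U a / T))) =
      fun a : ℝ => ENNReal.ofReal (a ^ (2 * j) * Real.exp (-(pinnedChain ω₂ lam β γ).U a / T)) := by
    funext a
    rw [ENNReal.ofReal_mul (h2j a)]
  rw [e]
  refine (lintegral_ofReal_ne_top_iff_integrable hc.aestronglyMeasurable
    (ae_of_all _ fun a => mul_nonneg (h2j a) (Real.exp_nonneg _))).mpr ?_
  have hg : Integrable fun a : ℝ => a ^ (2 * j) * Real.exp (-(ω₂ / (2 * T)) * a ^ 2) := by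
    have := integrable_rpow_mul_exp_neg_mul_sq (b := ω₂ / (2 * T)) (by positivity) (s := 2 * j)
      (by have : (0:ℝ) ≤ 2 * j := by positivity
          linarith)
    refine this.congr (ae_of_all _ fun a => ?_)
    simp only
    rw [show ((2 : ℝ) * j) = ((2 * j : ℕ) : ℝ) by push_cast; ring, Real.rpow_natCast]
  refine hg.mono' hc.aestronglyMeasurable (ae_of_all _ fun a => ?_)
  rw [Real.norm_eq_abs, abs_of_nonneg (mul_nonneg (h2j a) (Real.exp_nonneg _))]
  exact mul_le_mul_of_nonneg_left (pinnedChain_exp_neg_U_div_le hl γ hT a) (h2j a)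

/-- **`N`-uniform even one-site moments of the Gibbs weight, real form**: for every `N`, site `k` and `j`,
`∫ q_k^{2j} e^{-H/T} dx ≤ κ_{2j} ∫ e^{-H/T} dx`, `κ_{2j} = (∫ a^{2j} e^{-U/T} / ∫ e^{-U/T})` (a finite one-site
constant, written with `ENNReal.toReal`). [folklore] -/
theorem pinnedChain_integral_coord_pow_mul_gibbsDensity_le (N : ℕ) (k : Fin N) (j : ℕ) :
    ∫ x : PhaseSpace N, (x.1 k) ^ (2 * j) * (pinnedChain ω₂ lam β γ).gibbsDensity N T x ≤
      ((∫⁻ a, ENNReal.ofReal (a ^ (2 * j)) * ENNReal.ofReal (Real.exp (-(pinnedChain ω₂ lam β γ).U a / T))) /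
          ∫⁻ a, ENNReal.ofReal (Real.exp (-(pinnedChain ω₂ lam β γ).U a / T))).toReal *
        ∫ x : PhaseSpace N, (pinnedChain ω₂ lam β γ).gibbsDensity N T x := by
  set P := pinnedChain ω₂ lam β γ with hP
  set A := ∫⁻ a, ENNReal.ofReal (a ^ (2 * j)) * ENNReal.ofReal (Real.exp (-P.U a / T)) with hA
  set ZU := ∫⁻ a, ENNReal.ofReal (Real.exp (-P.U a / T)) with hZU
  have hAfin : A ≠ ⊤ := pinnedChain_lintegral_pow_mul_exp_neg_U_ne_top hω hl γ hT j
  have hZU0 : ZU ≠ 0 := pinnedChain_lintegral_exp_neg_U_ne_zero ω₂ lam β γ T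
  have hZUfin : ZU ≠ ⊤ := pinnedChain_lintegral_exp_neg_U_ne_top (β := β) hω hl γ hT
  have hh : Measurable fun a : ℝ => ENNReal.ofReal (a ^ (2 * j)) := by fun_prop
  have hhm : ∀ ⦃a b : ℝ⦄, |a| ≤ |b| → ENNReal.ofReal (a ^ (2 * j)) ≤ ENNReal.ofReal (b ^ (2 * j)) := by
    intro a b hab
    refine ENNReal.ofReal_le_ofReal ?_
    rw [pow_mul, pow_mul, ← sq_abs a, ← sq_abs b]
    exact pow_le_pow_left₀ (sq_nonneg _) (pow_le_pow_left₀ (abs_nonneg _) hab 2) j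
  have key := pinnedChain_lintegral_coord_gibbsWeight_le hω hl hβ γ hT k hh hhm
  -- rewrite the Gibbs-weight integrals as `ofReal` of Bochner integrals
  have hρi : Integrable (P.gibbsDensity N T) := pinnedChain_integrable_gibbsDensity hω hl hβ γ N hT
  have hρ0 : ∀ x, 0 ≤ P.gibbsDensity N T x := fun x => (P.gibbsDensity_pos N T x).le
  have hρc : Continuous (P.gibbsDensity N T) := pinnedChain_continuous_gibbsDensity ω₂ lam β γ N T
  have hqc : Continuous fun x : PhaseSpace N => (x.1 k) ^ (2 * j) := ((continuous_apply k).comp continuous_fst).pow _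
  have hnn : ∀ x : PhaseSpace N, 0 ≤ (x.1 k) ^ (2 * j) * P.gibbsDensity N T x := fun x =>
    mul_nonneg (by rw [pow_mul]; positivity) (hρ0 x)
  have hI : ∫⁻ x : PhaseSpace N, ENNReal.ofReal ((x.1 k) ^ (2 * j) * P.gibbsDensity N T x) =
      ∫⁻ x : PhaseSpace N, ENNReal.ofReal ((x.1 k) ^ (2 * j)) * ENNReal.ofReal (Real.exp (-P.hamiltonian N x / T)) := by
    refine lintegral_congr fun x => ?_
    rw [ENNReal.ofReal_mul (by rw [pow_mul]; positivity)]
    rfl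
  have hZ : ∫⁻ x : PhaseSpace N, ENNReal.ofReal (P.gibbsDensity N T x) =
      ∫⁻ x : PhaseSpace N, ENNReal.ofReal (Real.exp (-P.hamiltonian N x / T)) := rfl
  have hZfin : ∫⁻ x : PhaseSpace N, ENNReal.ofReal (P.gibbsDensity N T x) ≠ ⊤ :=
    (lintegral_ofReal_ne_top_iff_integrable hρi.aestronglyMeasurable (ae_of_all _ hρ0)).mpr hρi
  have key' : (∫⁻ x : PhaseSpace N, ENNReal.ofReal ((x.1 k) ^ (2 * j) * P.gibbsDensity N T x)) * ZU ≤
      A * ∫⁻ x : PhaseSpace N, ENNReal.ofReal (P.gibbsDensity N T x) := by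
    rw [hI, hZ]; exact key
  have hIfin : ∫⁻ x : PhaseSpace N, ENNReal.ofReal ((x.1 k) ^ (2 * j) * P.gibbsDensity N T x) ≠ ⊤ := by
    intro h
    rw [h, ENNReal.top_mul hZU0] at key'
    exact absurd key' (not_le.mpr (ENNReal.mul_lt_top hAfin.lt_top hZfin.lt_top))
  have hInt : Integrable fun x : PhaseSpace N => (x.1 k) ^ (2 * j) * P.gibbsDensity N T x :=
    (lintegral_ofReal_ne_top_iff_integrable (hqc.mul hρc).aestronglyMeasurable (ae_of_all _ hnn)).mp hIfin
  have e1 : ENNReal.ofReal (∫ x : PhaseSpace N, (x.1 k) ^ (2 * j) * P.gibbsDensity N T x) =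
      ∫⁻ x : PhaseSpace N, ENNReal.ofReal ((x.1 k) ^ (2 * j) * P.gibbsDensity N T x) :=
    ofReal_integral_eq_lintegral_ofReal hInt (ae_of_all _ hnn)
  have e2 : ENNReal.ofReal (∫ x, P.gibbsDensity N T x) = ∫⁻ x : PhaseSpace N, ENNReal.ofReal (P.gibbsDensity N T x) :=
    ofReal_integral_eq_lintegral_ofReal hρi (ae_of_all _ hρ0)
  have hreal : (∫ x : PhaseSpace N, (x.1 k) ^ (2 * j) * P.gibbsDensity N T x) * ZU.toReal ≤
      A.toReal * ∫ x, P.gibbsDensity N T x := by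
    have := ENNReal.toReal_mono (ENNReal.mul_ne_top hAfin hZfin) key'
    rwa [ENNReal.toReal_mul, ENNReal.toReal_mul, ← e1, ← e2, ENNReal.toReal_ofReal (integral_nonneg hnn),
      ENNReal.toReal_ofReal (integral_nonneg hρ0)] at this
  have hZUpos : 0 < ZU.toReal := ENNReal.toReal_pos hZU0 hZUfin
  rw [ENNReal.toReal_div, div_mul_eq_mul_div, le_div_iff₀ hZUpos]
  exact hreal

end OneSiteReal

/-! ### The force at a site is dominated by one-site polynomials -/

/-- `(x - y)⁶ ≤ 32 (x⁶ + y⁶)`. [folklore] -/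
theorem sub_pow_six_le (x y : ℝ) : (x - y) ^ 6 ≤ 32 * (x ^ 6 + y ^ 6) := by
  have h1 : (x - y) ^ 2 ≤ 2 * (x ^ 2 + y ^ 2) := by nlinarith [sq_nonneg (x + y)]
  have h2 : (x ^ 2 + y ^ 2) ^ 3 ≤ 4 * (x ^ 6 + y ^ 6) := by
    nlinarith [sq_nonneg (x ^ 2 - y ^ 2), sq_nonneg x, sq_nonneg y, mul_nonneg (sq_nonneg x) (sq_nonneg y),
      mul_nonneg (add_nonneg (sq_nonneg x) (sq_nonneg y)) (sq_nonneg (x^2 - y^2))]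
  have h0 : 0 ≤ (x - y) ^ 2 := sq_nonneg _
  calc (x - y) ^ 6 = ((x - y) ^ 2) ^ 3 := by ring
    _ ≤ (2 * (x ^ 2 + y ^ 2)) ^ 3 := pow_le_pow_left₀ h0 h1 3
    _ = 8 * (x ^ 2 + y ^ 2) ^ 3 := by ring
    _ ≤ 32 * (x ^ 6 + y ^ 6) := by nlinarith

/-- `V'(x-y)² ≤ 4x² + 4y² + 64β²(x⁶ + y⁶)` for the FPU-`β` coupling `V'(r) = r + βr³`. [folklore] -/
theorem pinnedChain_deriv_V_sub_sq_le (ω₂ lam β γ x y : ℝ) :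
    deriv (pinnedChain ω₂ lam β γ).V (x - y) ^ 2 ≤ 4 * x ^ 2 + 4 * y ^ 2 + 64 * β ^ 2 * (x ^ 6 + y ^ 6) := by
  rw [pinnedChain_deriv_V]
  set r := x - y with hr
  have h1 : (r + β * r ^ 3) ^ 2 ≤ 2 * r ^ 2 + 2 * β ^ 2 * r ^ 6 := by nlinarith [sq_nonneg (r - β * r ^ 3)]
  have h2 : r ^ 2 ≤ 2 * (x ^ 2 + y ^ 2) := by simp only [hr]; nlinarith [sq_nonneg (x + y)]
  have h3 : r ^ 6 ≤ 32 * (x ^ 6 + y ^ 6) := sub_pow_six_le x y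
  nlinarith [sq_nonneg β, mul_nonneg (sq_nonneg β) (by positivity : (0:ℝ) ≤ x ^ 6 + y ^ 6)]

/-- `U'(a)² ≤ 2ω₂²a² + 2lam²a⁶` for the pinning `U'(a) = ω₂a + lam a³`. [folklore] -/
theorem pinnedChain_deriv_U_sq_le (ω₂ lam β γ a : ℝ) :
    deriv (pinnedChain ω₂ lam β γ).U a ^ 2 ≤ 2 * ω₂ ^ 2 * a ^ 2 + 2 * lam ^ 2 * a ^ 6 := by
  rw [pinnedChain_deriv_U]
  nlinarith [sq_nonneg (ω₂ * a - lam * a ^ 3)]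

/-- A sum over the (at most one) left neighbour: `(∑_a [i=a+1] v_a)² ≤ ∑_a [i=a+1] v_a²`. [folklore] -/
theorem sq_sum_ite_pred_le (i : Fin N) (v : Fin N → ℝ) :
    (∑ a : Fin N, if i.val = a.val + 1 then v a else 0) ^ 2 ≤ ∑ a : Fin N, if i.val = a.val + 1 then v a ^ 2 else 0 := by
  have hcs := Finset.sum_mul_sq_le_sq_mul_sq (Finset.univ : Finset (Fin N))
    (fun a => if i.val = a.val + 1 then (1:ℝ) else 0) (fun a => if i.val = a.val + 1 then v a else 0)
  have e1 : ∀ a : Fin N, (if i.val = a.val + 1 then (1:ℝ) else 0) * (if i.val = a.val + 1 then v a else 0) =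
      (if i.val = a.val + 1 then v a else 0) := fun a => by split_ifs <;> simp
  have e2 : ∀ a : Fin N, (if i.val = a.val + 1 then (1:ℝ) else 0) ^ 2 = (if i.val = a.val + 1 then (1:ℝ) else 0) :=
    fun a => by split_ifs <;> simp
  have e3 : ∀ a : Fin N, (if i.val = a.val + 1 then v a else 0) ^ 2 = (if i.val = a.val + 1 then v a ^ 2 else 0) :=
    fun a => by split_ifs <;> simp
  simp only [e1, e2, e3] at hcs
  have hle1 := sum_ite_succ_left_le_one (N := N) i
  have hnn : 0 ≤ ∑ a : Fin N, (if i.val = a.val + 1 then v a ^ 2 else 0) :=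
    Finset.sum_nonneg fun a _ => by split_ifs <;> positivity
  calc _ ≤ _ := hcs
    _ ≤ 1 * ∑ a : Fin N, (if i.val = a.val + 1 then v a ^ 2 else 0) := mul_le_mul_of_nonneg_right hle1 hnn
    _ = _ := one_mul _

/-- A sum over the (at most one) right neighbour: `(∑_l [l=i+1] v_l)² ≤ ∑_l [l=i+1] v_l²`. [folklore] -/
theorem sq_sum_ite_succ_le (i : Fin N) (v : Fin N → ℝ) :
    (∑ l : Fin N, if l.val = i.val + 1 then v l else 0) ^ 2 ≤ ∑ l : Fin N, if l.val = i.val + 1 then v l ^ 2 else 0 := by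
  have hcs := Finset.sum_mul_sq_le_sq_mul_sq (Finset.univ : Finset (Fin N))
    (fun l => if l.val = i.val + 1 then (1:ℝ) else 0) (fun l => if l.val = i.val + 1 then v l else 0)
  have e1 : ∀ l : Fin N, (if l.val = i.val + 1 then (1:ℝ) else 0) * (if l.val = i.val + 1 then v l else 0) =
      (if l.val = i.val + 1 then v l else 0) := fun l => by split_ifs <;> simp
  have e2 : ∀ l : Fin N, (if l.val = i.val + 1 then (1:ℝ) else 0) ^ 2 = (if l.val = i.val + 1 then (1:ℝ) else 0) :=
    fun l => by split_ifs <;> simp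
  have e3 : ∀ l : Fin N, (if l.val = i.val + 1 then v l else 0) ^ 2 = (if l.val = i.val + 1 then v l ^ 2 else 0) :=
    fun l => by split_ifs <;> simp
  simp only [e1, e2, e3] at hcs
  have hle1 := sum_ite_succ_right_le_one (N := N) i
  have hnn : 0 ≤ ∑ l : Fin N, (if l.val = i.val + 1 then v l ^ 2 else 0) :=
    Finset.sum_nonneg fun l _ => by split_ifs <;> positivity
  calc _ ≤ _ := hcs
    _ ≤ 1 * ∑ l : Fin N, (if l.val = i.val + 1 then v l ^ 2 else 0) := mul_le_mul_of_nonneg_right hle1 hnn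
    _ = _ := one_mul _

/-- **The squared force at a site is dominated by quadratic and sextic one-site terms** at the site and its (at
most two) neighbours:
`(∂_iΦ)² ≤ (6ω₂²+24) q_i² + (6lam²+384β²) q_i⁶ + ∑_a [i=a+1](12 q_a² + 192β² q_a⁶) + ∑_l [l=i+1](12 q_l² + 192β² q_l⁶)`.
[folklore] -/
theorem pinnedChain_dPotential_sq_le (ω₂ lam β γ : ℝ) (q : Fin N → ℝ) (i : Fin N) :
    (pinnedChain ω₂ lam β γ).dPotential N i q ^ 2 ≤
      (6 * ω₂ ^ 2 + 24) * q i ^ 2 + (6 * lam ^ 2 + 384 * β ^ 2) * q i ^ 6 +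
        (∑ a : Fin N, if i.val = a.val + 1 then 12 * q a ^ 2 + 192 * β ^ 2 * q a ^ 6 else 0) +
        ∑ l : Fin N, if l.val = i.val + 1 then 12 * q l ^ 2 + 192 * β ^ 2 * q l ^ 6 else 0 := by
  set P := pinnedChain ω₂ lam β γ with hP
  -- split the bond double sum into the left-neighbour and right-neighbour single sums
  set S₁ : ℝ := ∑ a : Fin N, if i.val = a.val + 1 then deriv P.V (q i - q a) else 0 with hS₁
  set S₂ : ℝ := ∑ l : Fin N, if l.val = i.val + 1 then deriv P.V (q l - q i) else 0 with hS₂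
  have hsum : (∑ k : Fin N, ∑ l : Fin N, if l.val = k.val + 1 then
      deriv P.V (q l - q k) * ((if l = i then 1 else 0) - (if k = i then 1 else 0)) else 0) = S₁ - S₂ := by
    have e : ∀ k l : Fin N, (if l.val = k.val + 1 then
        deriv P.V (q l - q k) * ((if l = i then 1 else 0) - (if k = i then 1 else 0)) else 0) =
        (if l.val = k.val + 1 then deriv P.V (q l - q k) * (if l = i then 1 else 0) else 0) -
          (if l.val = k.val + 1 then deriv P.V (q l - q k) * (if k = i then 1 else 0) else 0) := by
      intro k l; split_ifs <;> ring
    simp_rw [e, Finset.sum_sub_distrib]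
    congr 1
    · -- collapse `l := i`
      simp only [hS₁]
      refine Finset.sum_congr rfl fun k _ => ?_
      rw [Finset.sum_eq_single i]
      · simp only [if_true, mul_one]
      · intro l _ hl; simp [hl]
      · intro h; exact absurd (Finset.mem_univ i) h
    · -- collapse `k := i`
      simp only [hS₂]
      rw [Finset.sum_comm]
      refine Finset.sum_congr rfl fun l _ => ?_
      rw [Finset.sum_eq_single i]
      · simp only [if_true, mul_one]
      · intro k _ hk; simp [hk]
      · intro h; exact absurd (Finset.mem_univ i) h
  have hdP : P.dPotential N i q = deriv P.U (q i) + (S₁ - S₂) := by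
    unfold OscillatorChain.dPotential; rw [hsum]
  -- squares of the pieces
  have hU := pinnedChain_deriv_U_sq_le ω₂ lam β γ (q i)
  have h1 : S₁ ^ 2 ≤ ∑ a : Fin N, if i.val = a.val + 1 then deriv P.V (q i - q a) ^ 2 else 0 :=
    sq_sum_ite_pred_le i (fun a => deriv P.V (q i - q a))
  have h2 : S₂ ^ 2 ≤ ∑ l : Fin N, if l.val = i.val + 1 then deriv P.V (q l - q i) ^ 2 else 0 :=
    sq_sum_ite_succ_le i (fun l => deriv P.V (q l - q i))
  have h1' : (∑ a : Fin N, if i.val = a.val + 1 then deriv P.V (q i - q a) ^ 2 else 0) ≤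
      (4 * q i ^ 2 + 64 * β ^ 2 * q i ^ 6) + ∑ a : Fin N, if i.val = a.val + 1 then 4 * q a ^ 2 + 64 * β ^ 2 * q a ^ 6 else 0 := by
    calc (∑ a : Fin N, if i.val = a.val + 1 then deriv P.V (q i - q a) ^ 2 else 0)
        ≤ ∑ a : Fin N, if i.val = a.val + 1 then (4 * q i ^ 2 + 64 * β ^ 2 * q i ^ 6) + (4 * q a ^ 2 + 64 * β ^ 2 * q a ^ 6) else 0 := by
          refine Finset.sum_le_sum fun a _ => ?_
          split_ifs
          · have := pinnedChain_deriv_V_sub_sq_le ω₂ lam β γ (q i) (q a); nlinarith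
          · exact le_rfl
      _ = (4 * q i ^ 2 + 64 * β ^ 2 * q i ^ 6) * (∑ a : Fin N, if i.val = a.val + 1 then (1:ℝ) else 0) +
            ∑ a : Fin N, if i.val = a.val + 1 then 4 * q a ^ 2 + 64 * β ^ 2 * q a ^ 6 else 0 := by
          rw [Finset.mul_sum, ← Finset.sum_add_distrib]
          refine Finset.sum_congr rfl fun a _ => ?_
          split_ifs <;> ring
      _ ≤ (4 * q i ^ 2 + 64 * β ^ 2 * q i ^ 6) * 1 +
            ∑ a : Fin N, if i.val = a.val + 1 then 4 * q a ^ 2 + 64 * β ^ 2 * q a ^ 6 else 0 := by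
          refine add_le_add (mul_le_mul_of_nonneg_left (sum_ite_succ_left_le_one i) (by positivity)) le_rfl
      _ = _ := by rw [mul_one]
  have h2' : (∑ l : Fin N, if l.val = i.val + 1 then deriv P.V (q l - q i) ^ 2 else 0) ≤
      (4 * q i ^ 2 + 64 * β ^ 2 * q i ^ 6) + ∑ l : Fin N, if l.val = i.val + 1 then 4 * q l ^ 2 + 64 * β ^ 2 * q l ^ 6 else 0 := by
    calc (∑ l : Fin N, if l.val = i.val + 1 then deriv P.V (q l - q i) ^ 2 else 0)
        ≤ ∑ l : Fin N, if l.val = i.val + 1 then (4 * q i ^ 2 + 64 * β ^ 2 * q i ^ 6) + (4 * q l ^ 2 + 64 * β ^ 2 * q l ^ 6) else 0 := by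
          refine Finset.sum_le_sum fun l _ => ?_
          split_ifs
          · have := pinnedChain_deriv_V_sub_sq_le ω₂ lam β γ (q l) (q i); nlinarith
          · exact le_rfl
      _ = (4 * q i ^ 2 + 64 * β ^ 2 * q i ^ 6) * (∑ l : Fin N, if l.val = i.val + 1 then (1:ℝ) else 0) +
            ∑ l : Fin N, if l.val = i.val + 1 then 4 * q l ^ 2 + 64 * β ^ 2 * q l ^ 6 else 0 := by
          rw [Finset.mul_sum, ← Finset.sum_add_distrib]
          refine Finset.sum_congr rfl fun l _ => ?_
          split_ifs <;> ring
      _ ≤ (4 * q i ^ 2 + 64 * β ^ 2 * q i ^ 6) * 1 +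
            ∑ l : Fin N, if l.val = i.val + 1 then 4 * q l ^ 2 + 64 * β ^ 2 * q l ^ 6 else 0 := by
          refine add_le_add (mul_le_mul_of_nonneg_left (sum_ite_succ_right_le_one i) (by positivity)) le_rfl
      _ = _ := by rw [mul_one]
  -- `(u + (S₁ - S₂))² ≤ 3(u² + S₁² + S₂²)`
  have h3 : P.dPotential N i q ^ 2 ≤ 3 * (deriv P.U (q i) ^ 2 + S₁ ^ 2 + S₂ ^ 2) := by
    rw [hdP]; nlinarith [sq_nonneg (deriv P.U (q i) - S₁), sq_nonneg (deriv P.U (q i) + S₂), sq_nonneg (S₁ + S₂)]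
  have e4 : (∑ a : Fin N, if i.val = a.val + 1 then 12 * q a ^ 2 + 192 * β ^ 2 * q a ^ 6 else 0) =
      3 * ∑ a : Fin N, if i.val = a.val + 1 then 4 * q a ^ 2 + 64 * β ^ 2 * q a ^ 6 else 0 := by
    rw [Finset.mul_sum]; refine Finset.sum_congr rfl fun a _ => ?_; split_ifs <;> ring
  have e5 : (∑ l : Fin N, if l.val = i.val + 1 then 12 * q l ^ 2 + 192 * β ^ 2 * q l ^ 6 else 0) =
      3 * ∑ l : Fin N, if l.val = i.val + 1 then 4 * q l ^ 2 + 64 * β ^ 2 * q l ^ 6 else 0 := by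
    rw [Finset.mul_sum]; refine Finset.sum_congr rfl fun l _ => ?_; split_ifs <;> ring
  rw [e4, e5]
  nlinarith

end Summit.AtomisticToContinuum.FouriersLaw.Theorems.ChainVariation

end
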